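import Summits.Ventures.Crystal3D.Theorems.StickyWulffConstantCoaxialWallLawAutomatonCore
import Summits.Ventures.Crystal3D.Theorems.StickyWulffConstantCoaxialWallLawSources
import Summits.Ventures.Crystal3D.Theorems.StickyWulffConstantCoaxialWallLawBandCount
import Summits.Ventures.Crystal3D.Theorems.StickyWulffConstantCoaxialWallLawTwinFrames
import HarnessLib

/-!
# The flux gap in the co-axial translation cell: payers ≥ (√2 (α_max − α_min) π ρ² − #foreign − O((1+h)ρ))/26

HONEST FRAMING. Part of the venture `Summits/Ventures/Crystal3D` (cell `crystal3d-full`), helper for the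
crux `CoaxialWallLaw` (stmt-Ventures-19481) of `route-Ventures-StickyWulffConstant`, REGISTERED line
`WallLedgerF` (planner cf-p1 gen 16), open stub `stub_coaxialTwoSlabAdhesion` (general fillings).  Brick 13
of the FLUX-GAP architecture (memo F-FLUXGAP-ARCH §2): the automaton INSTANTIATED for a co-axial
TRANSLATION pair in normal form — both grains are cosets `F false·Λ₀ + s₁ ≠ F false·Λ₀ + s₂` of the SAME
frame (`{F false, F true} = {L, L∘R}`, axis `n = ±L e₃`; the twin class `F true` is still needed to walk
through coherent faults/twin lamellae of the lamination plane).  The designated slot of the bottom class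
now depends on the COSET of the ball: `F false u_max` off `Λ₂`, `F false u_min` on `Λ₂` (coset-invariant,
so `dsg_invariant` holds), `F true u_max` in the twin class; lines therefore leave the inner bottom sample
with flux `√2 α_max π ρ²` but can enter the sealed top window only along `u_min`, capacity `√2 α_min π ρ²`:
the gap is `√2 (α_max − α_min) π ρ² ≥ (√6/2) sin θ · π ρ²` (`exists_far_slots_spread`, next file).
Rung credit only; F-C1 not moved.

**Theorem (`fluxGap_trans_payers_ge`).**  In the two-slab cell (`X` `1`-separated in
`{−2R₀ ≤ x₂ ≤ h + 2R₀, lateral ≤ ρ}`, `10 ≤ R₀ ≤ ρ`, samples `P₁ ⊆ F false·Λ₀ + s₁`, `P₂ ⊆ F false·Λ₀ + s₂`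
complete in their windows, the two cosets different; inputs `KissingGap δ`, `KissingClassification δ` by
name), for far slots `u_max, u_min` of the axis with `α_max = (F false u_max)₂ > 0`,
`α_min = (F false u_min)₂ > 0`, `(F true u_max)₂ > 0`, and `K = (R₀ − 1)/2 + 4`:
`√2 (α_max − α_min) π ρ² − (12√2π + 2√2πK + 36R₀ + 288) ρ − √2 π K²/α_min
   ≤ 26 · #{z ∈ X : deg z ≤ 11, −R₀ − 2 ≤ z₂ ≤ h + R₀ + 2} + 2 · #FOREIGN`,
`FOREIGN` as in `…FluxGapCell` (twin dozens of either frame for a `{111}` normal `n′ ≠ ±n`).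

WHAT THIS IS NOT: not the stub; F-C1 not moved.
-/

noncomputable section

namespace Summit.Ventures.Crystal3D.Theorems

open Summit.Ventures.Crystal3D Finset
open Literature.MathematicalPhysics.StatisticalMechanics (fccStacking)
open scoped InnerProductSpace

/-- Two cosets of one moved lattice that meet are equal (as a subset statement). -/
theorem movedFcc_subset_of_mem_of_mem (A : EuclideanSpace ℝ (Fin 3) ≃ₗᵢ[ℝ] EuclideanSpace ℝ (Fin 3))
    (s₁ s₂ : EuclideanSpace ℝ (Fin 3)) {p : EuclideanSpace ℝ (Fin 3)}
    (h₁ : p ∈ (fun q => A q + s₁) '' fccStacking 1 (Real.sqrt (2 / 3)))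
    (h₂ : p ∈ (fun q => A q + s₂) '' fccStacking 1 (Real.sqrt (2 / 3))) :
    (fun q => A q + s₁) '' fccStacking 1 (Real.sqrt (2 / 3)) ⊆
      (fun q => A q + s₂) '' fccStacking 1 (Real.sqrt (2 / 3)) := by
  rintro x ⟨qx, hqx, rfl⟩
  obtain ⟨qp, hqp, hp⟩ := h₁
  obtain ⟨q', hq', hp'⟩ := h₂
  simp only at hp hp'
  refine ⟨qx + (q' - qp), fcc_add_site_mem hqx (fcc_sub_site_mem hq' hqp), ?_⟩
  have e : s₁ = p - A qp := by rw [← hp]; abel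
  simp only [map_add, map_sub]
  rw [e, ← hp']
  abel

open scoped Classical in
/-- **The flux gap feeds the payers (co-axial translation cell, normal form).**  See the module
docstring. -/
theorem fluxGap_trans_payers_ge {δ : ℝ} (hg : KissingGap δ) (hc : KissingClassification δ)
    (L : EuclideanSpace ℝ (Fin 3) ≃ₗᵢ[ℝ] EuclideanSpace ℝ (Fin 3))
    (F : Bool → (EuclideanSpace ℝ (Fin 3) ≃ₗᵢ[ℝ] EuclideanSpace ℝ (Fin 3)))
    (hF : (F false = L ∧ F true = (ℝ ∙ EuclideanSpace.single (2 : Fin 3) (1 : ℝ)).reflection.trans L) ∨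
      (F false = (ℝ ∙ EuclideanSpace.single (2 : Fin 3) (1 : ℝ)).reflection.trans L ∧ F true = L))
    {n : EuclideanSpace ℝ (Fin 3)}
    (hn : n = L (EuclideanSpace.single (2 : Fin 3) (1 : ℝ)) ∨ n = -L (EuclideanSpace.single (2 : Fin 3) (1 : ℝ)))
    {umax umin : EuclideanSpace ℝ (Fin 3)} (humax : umax ∈ fccSlots) (humin : umin ∈ fccSlots)
    (hfar₁ : ⟪F false umax, n⟫_ℝ = Real.sqrt (2 / 3)) (hfar₂ : ⟪F false umin, n⟫_ℝ = Real.sqrt (2 / 3))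
    (hα₁ : 0 < (F false umax) 2) (hα₂ : 0 < (F false umin) 2) (hαt : 0 < (F true umax) 2)
    (s₁ s₂ : EuclideanSpace ℝ (Fin 3))
    (hne : (fun q => F false q + s₁) '' fccStacking 1 (Real.sqrt (2 / 3)) ≠
      (fun q => F false q + s₂) '' fccStacking 1 (Real.sqrt (2 / 3)))
    (X P₁ P₂ : Finset (EuclideanSpace ℝ (Fin 3))) (R₀ h ρ : ℝ)
    (hR₀ : 10 ≤ R₀) (hh : 0 ≤ h) (hρ : R₀ ≤ ρ)
    (hX : ∀ p ∈ X, ∀ q ∈ X, p ≠ q → 1 ≤ dist p q)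
    (hcell : ∀ p ∈ X, -(2 * R₀) ≤ p 2 ∧ p 2 ≤ h + 2 * R₀ ∧ p 0 ^ 2 + p 1 ^ 2 ≤ ρ ^ 2)
    (hP₁X : P₁ ⊆ X) (hP₂X : P₂ ⊆ X)
    (hP₁ : ∀ p, p ∈ P₁ ↔ (p ∈ (fun q => F false q + s₁) '' fccStacking 1 (Real.sqrt (2 / 3)) ∧
      -(2 * R₀) ≤ p 2 ∧ p 2 ≤ -R₀ ∧ p 0 ^ 2 + p 1 ^ 2 ≤ ρ ^ 2))
    (hP₂ : ∀ p, p ∈ P₂ ↔ (p ∈ (fun q => F false q + s₂) '' fccStacking 1 (Real.sqrt (2 / 3)) ∧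
      h + R₀ ≤ p 2 ∧ p 2 ≤ h + 2 * R₀ ∧ p 0 ^ 2 + p 1 ^ 2 ≤ ρ ^ 2)) :
    Real.sqrt 2 * ((F false umax) 2 - (F false umin) 2) * Real.pi * ρ ^ 2 -
        (12 * Real.sqrt 2 * Real.pi + 2 * Real.sqrt 2 * Real.pi * ((R₀ - 1) / 2 + 4) + 36 * R₀ + 288) * ρ -
        Real.sqrt 2 * Real.pi * ((R₀ - 1) / 2 + 4) ^ 2 / (F false umin) 2 ≤
      26 * ((X.filter fun z => (X.filter fun q => dist z q = 1).card ≤ 11 ∧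
          -R₀ - 2 ≤ z 2 ∧ z 2 ≤ h + R₀ + 2).card : ℝ) +
      2 * ((X.filter fun b => ∃ c : Bool, ∃ n' : EuclideanSpace ℝ (Fin 3), ‖n'‖ = 1 ∧ n' ≠ n ∧ n' ≠ -n ∧
          (∀ w ∈ fccSlots, ⟪F c w, n'⟫_ℝ = 0 ∨ ⟪F c w, n'⟫_ℝ = Real.sqrt (2 / 3) ∨
            ⟪F c w, n'⟫_ℝ = -Real.sqrt (2 / 3)) ∧
          (∀ w ∈ fccSlots, ⟪F c w, n'⟫_ℝ ≤ 0 → b + F c w ∈ X) ∧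
          (∀ w ∈ fccSlots, ⟪F c w, n'⟫_ℝ < 0 → b + (F c w - (2 * ⟪F c w, n'⟫_ℝ) • n') ∈ X) ∧
          (∀ w ∈ fccSlots, 0 < ⟪F c w, n'⟫_ℝ → b + F c w ∉ X)).card : ℝ) := by
  set e₃ : EuclideanSpace ℝ (Fin 3) := EuclideanSpace.single (2 : Fin 3) (1 : ℝ) with he₃
  set RL := (ℝ ∙ EuclideanSpace.single (2 : Fin 3) (1 : ℝ)).reflection.trans L with hRL
  have hr : 0 < Real.sqrt (2 / 3) := Real.sqrt_pos.2 (by norm_num)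
  have hR₀3 : (3 : ℝ) ≤ R₀ := by linarith
  have hρ0 : (0 : ℝ) ≤ ρ := by linarith
  -- the axis: unit, and `⟪F c w, n⟫ = ± w₂`
  have hn1 : ‖n‖ = 1 := by
    rcases hn with rfl | rfl
    · rw [LinearIsometryEquiv.norm_map, he₃, PiLp.norm_single, norm_one]
    · rw [norm_neg, LinearIsometryEquiv.norm_map, he₃, PiLp.norm_single, norm_one]
  have hax : ∀ c w, ⟪F c w, L e₃⟫_ℝ = w 2 := by
    intro c w
    rcases hF with ⟨h0, h1⟩ | ⟨h0, h1⟩ <;> cases c <;> simp only [h0, h1]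
    · exact inner_frame_axis L w
    · exact inner_twinFrame_axis L w
    · exact inner_twinFrame_axis L w
    · exact inner_frame_axis L w
  have haxn : ∀ c w, ⟪F c w, n⟫_ℝ = w 2 ∨ ⟪F c w, n⟫_ℝ = -w 2 := by
    intro c w
    rcases hn with rfl | rfl
    · exact Or.inl (hax c w)
    · exact Or.inr (by rw [inner_neg_right, hax])
  have hmenu : ∀ c, ∀ w ∈ fccSlots,
      ⟪F c w, n⟫_ℝ = 0 ∨ ⟪F c w, n⟫_ℝ = Real.sqrt (2 / 3) ∨ ⟪F c w, n⟫_ℝ = -Real.sqrt (2 / 3) := by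
    intro c w hw
    rcases haxn c w with h | h <;> rcases slot_apply_two_cases hw with h' | h' | h' <;> rw [h, h']
    · exact Or.inl rfl
    · exact Or.inr (Or.inl rfl)
    · exact Or.inr (Or.inr rfl)
    · exact Or.inl neg_zero
    · exact Or.inr (Or.inr rfl)
    · exact Or.inr (Or.inl (neg_neg _))
  -- the mirror relation with `w' = −w`
  have hmir : ∀ c, ∀ w ∈ fccSlots, ∃ w' ∈ fccSlots, F (!c) w' = F c w - (2 * ⟪F c w, n⟫_ℝ) • n := by
    intro c w hw
    refine ⟨-w, neg_mem_fccSlots hw, ?_⟩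
    rcases hF with ⟨h0, h1⟩ | ⟨h0, h1⟩ <;> cases c <;> simp only [Bool.not_false, Bool.not_true, h0, h1]
    · exact twinFrame_neg_eq L hn w
    · exact frame_neg_eq L hn w
    · exact frame_neg_eq L hn w
    · exact twinFrame_neg_eq L hn w
  -- the far slots are far for both frames; `u_max` is non-horizontal
  have hfar' : ∀ c u, ⟪F false u, n⟫_ℝ = Real.sqrt (2 / 3) → ⟪F c u, n⟫_ℝ = Real.sqrt (2 / 3) := by
    intro c u hfar
    rcases hn with hn' | hn'
    · rw [hn', hax] at hfar ⊢; exact hfar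
    · rw [hn', inner_neg_right, hax] at hfar ⊢; exact hfar
  have hu2 : umax 2 ≠ 0 := by
    intro h0
    have hfar := hfar₁
    rcases haxn false umax with h | h <;> rw [h, h0] at hfar
    · exact hr.ne' hfar.symm
    · rw [neg_zero] at hfar; exact hr.ne' hfar.symm
  -- the two cosets are disjoint and coset membership is slot-invariant
  set Λ₂ := (fun q => F false q + s₂) '' fccStacking 1 (Real.sqrt (2 / 3)) with hΛ₂
  have hdisj : ∀ p ∈ (fun q => F false q + s₁) '' fccStacking 1 (Real.sqrt (2 / 3)), p ∉ Λ₂ := by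
    intro p hp₁ hp₂
    exact hne (Set.Subset.antisymm (movedFcc_subset_of_mem_of_mem (F false) s₁ s₂ hp₁ hp₂)
      (movedFcc_subset_of_mem_of_mem (F false) s₂ s₁ hp₂ hp₁))
  have hcoset : ∀ b, ∀ w ∈ fccStacking 1 (Real.sqrt (2 / 3)), b + F false w ∈ Λ₂ ↔ b ∈ Λ₂ := by
    intro b w hw
    constructor
    · intro h
      have := movedFcc_add_site_mem (F false) s₂ h (fcc_neg_mem hw)
      rwa [map_neg, add_neg_cancel_right] at this
    · intro h
      exact movedFcc_add_site_mem (F false) s₂ h hw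
  -- predicates and designated vectors
  set Full : Bool → EuclideanSpace ℝ (Fin 3) → Prop := fun c b => ∀ w ∈ fccSlots, b + F c w ∈ X with hFulldef
  set TD : Bool → EuclideanSpace ℝ (Fin 3) → Prop := fun c b =>
    (∀ w ∈ fccSlots, ⟪F c w, n⟫_ℝ ≤ 0 → b + F c w ∈ X) ∧
    (∀ w ∈ fccSlots, ⟪F c w, n⟫_ℝ < 0 → b + (F c w - (2 * ⟪F c w, n⟫_ℝ) • n) ∈ X) ∧
    (∀ w ∈ fccSlots, 0 < ⟪F c w, n⟫_ℝ → b + F c w ∉ X) with hTDdef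
  set Inv : Bool → EuclideanSpace ℝ (Fin 3) → Prop := fun c b => ∃ a ∈ fccSlots, ∃ a' ∈ fccSlots, ∃ a'' ∈ fccSlots,
    LinearIndependent ℝ ![a, a', a''] ∧ b + F c a ∈ X ∧ b + F c a' ∈ X ∧ b + F c a'' ∈ X with hInvdef
  set dsg : Bool → EuclideanSpace ℝ (Fin 3) → EuclideanSpace ℝ (Fin 3) := fun c b =>
    cond c (F true umax) (@ite _ (b ∈ Λ₂) (Classical.propDecidable _) (F false umin) (F false umax))
    with hdsgdef
  have hdsg_t : ∀ b, dsg true b = F true umax := fun b => rfl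
  have hdsg_on : ∀ b, b ∈ Λ₂ → dsg false b = F false umin := fun b hb => by
    show @ite _ (b ∈ Λ₂) (Classical.propDecidable _) (F false umin) (F false umax) = F false umin
    rw [if_pos hb]
  have hdsg_off : ∀ b, b ∉ Λ₂ → dsg false b = F false umax := fun b hb => by
    show @ite _ (b ∈ Λ₂) (Classical.propDecidable _) (F false umin) (F false umax) = F false umax
    rw [if_neg hb]
  have hFull : ∀ c b, Full c b ↔ ∀ w ∈ fccSlots, b + F c w ∈ X := fun c b => Iff.rfl
  have hTD : ∀ c b, TD c b ↔
      ((∀ w ∈ fccSlots, ⟪F c w, n⟫_ℝ ≤ 0 → b + F c w ∈ X) ∧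
       (∀ w ∈ fccSlots, ⟪F c w, n⟫_ℝ < 0 → b + (F c w - (2 * ⟪F c w, n⟫_ℝ) • n) ∈ X) ∧
       (∀ w ∈ fccSlots, 0 < ⟪F c w, n⟫_ℝ → b + F c w ∉ X)) := fun c b => Iff.rfl
  have hInv : ∀ c b, Inv c b ↔ ∃ a ∈ fccSlots, ∃ a' ∈ fccSlots, ∃ a'' ∈ fccSlots,
      LinearIndependent ℝ ![a, a', a''] ∧ b + F c a ∈ X ∧ b + F c a' ∈ X ∧ b + F c a'' ∈ X := fun c b => Iff.rfl
  have hdsg_up : ∀ c b, ∃ u ∈ fccSlots, ⟪F c u, n⟫_ℝ = Real.sqrt (2 / 3) ∧ dsg c b = F c u := by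
    intro c b; cases c
    · by_cases hb : b ∈ Λ₂
      · exact ⟨umin, humin, hfar₂, hdsg_on b hb⟩
      · exact ⟨umax, humax, hfar₁, hdsg_off b hb⟩
    · exact ⟨umax, humax, hfar' true umax hfar₁, hdsg_t b⟩
  have hdsg_inv : ∀ c b, ∀ w ∈ fccStacking 1 (Real.sqrt (2 / 3)), dsg c (b + F c w) = dsg c b := by
    intro c b w hw; cases c
    · by_cases hb : b ∈ Λ₂
      · rw [hdsg_on b hb, hdsg_on _ ((hcoset b w hw).2 hb)]
      · rw [hdsg_off b hb, hdsg_off _ (fun h' => hb ((hcoset b w hw).1 h'))]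
    · rfl
  have hrise : ∀ c b, 0 < dsg c b 2 := by
    intro c b; cases c
    · by_cases hb : b ∈ Λ₂
      · rw [hdsg_on b hb]; exact hα₂
      · rw [hdsg_off b hb]; exact hα₁
    · exact hαt
  set f : EuclideanSpace ℝ (Fin 3) × Bool → EuclideanSpace ℝ (Fin 3) × Bool := fun v =>
    @ite _ (Full v.2 v.1) (Classical.propDecidable _) (v.1 + dsg v.2 v.1, v.2)
      (v.1 + dsg (!v.2) v.1, !v.2) with hfdef
  -- the inner sample and the state space
  set zlo : ℝ := -R₀ - 1 with hzlo
  set zcut : ℝ := h + R₀ + 1 with hzcut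
  set P' : Finset (EuclideanSpace ℝ (Fin 3)) := P₁.filter fun p =>
    -(2 * R₀) + 1 ≤ p 2 ∧ p 2 ≤ -R₀ - 1 ∧ p 0 ^ 2 + p 1 ^ 2 ≤ (ρ - 1) ^ 2 with hP'def
  have hP'iff : ∀ p, p ∈ P' ↔ (p ∈ (fun q => F false q + s₁) '' fccStacking 1 (Real.sqrt (2 / 3)) ∧
      -(2 * R₀) + 1 ≤ p 2 ∧ p 2 ≤ -R₀ - 1 ∧ p 0 ^ 2 + p 1 ^ 2 ≤ (ρ - 1) ^ 2) := by
    intro p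
    rw [hP'def, mem_filter, hP₁]
    constructor
    · rintro ⟨⟨hΛ, -, -, -⟩, h1, h2, h3⟩; exact ⟨hΛ, h1, h2, h3⟩
    · rintro ⟨hΛ, h1, h2, h3⟩
      have hρ1 : (0 : ℝ) ≤ ρ - 1 := by linarith
      exact ⟨⟨hΛ, by linarith, by linarith, by nlinarith⟩, h1, h2, h3⟩
  have hP'X : P' ⊆ X := (filter_subset _ _).trans hP₁X
  have hP'top : ∀ p ∈ P', p 2 ≤ zlo := fun p hp => by rw [hzlo]; exact ((hP'iff p).1 hp).2.2.1
  have hsrc : ∀ p ∈ P', dsg false p = F false umax :=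
    fun p hp => hdsg_off p (hdisj p ((hP'iff p).1 hp).1)
  set V : Finset (EuclideanSpace ℝ (Fin 3) × Bool) := (X ×ˢ (univ : Finset Bool)).filter fun v =>
    zlo ≤ v.1 2 ∧ v.1 2 < zcut ∧ v.1 ∉ P' ∧ Inv v.2 v.1 ∧
      ∃ w ∈ fccSlots, ⟪F v.2 w, n⟫_ℝ < 0 ∧ v.1 + F v.2 w ∈ X with hVdef
  have hV : ∀ v, v ∈ V ↔ (v.1 ∈ X ∧ zlo ≤ v.1 2 ∧ v.1 2 < zcut ∧ v.1 ∉ P' ∧ Inv v.2 v.1 ∧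
      ∃ w ∈ fccSlots, ⟪F v.2 w, n⟫_ℝ < 0 ∧ v.1 + F v.2 w ∈ X) := by
    intro v
    rw [hVdef, mem_filter, mem_product]
    simp only [mem_univ, and_true]
  -- the top sample data for `…AutomatonTrans`
  have hcell' : ∀ p ∈ X, p 2 ≤ h + 2 * R₀ ∧ p 0 ^ 2 + p 1 ^ 2 ≤ ρ ^ 2 :=
    fun p hp => ⟨(hcell p hp).2.1, (hcell p hp).2.2⟩
  have hsh : ∀ b ∈ (fun q => F false q + s₂) '' fccStacking 1 (Real.sqrt (2 / 3)), dsg false b = F false umin :=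
    fun b hb => hdsg_on b hb
  have hnon : ∀ b, ∀ w ∈ fccSlots, dsg (!false) b ≠ F false w := by
    intro b w hw
    show F true umax ≠ F false w
    rcases hF with ⟨h0, h1⟩ | ⟨h0, h1⟩ <;> rw [h0, h1]
    · exact (frame_ne_twinFrame L humax hu2 hw).2
    · exact (frame_ne_twinFrame L humax hu2 hw).1
  -- (1) the automaton count
  have hcore := card_sources_le_automaton (f := f) (cΛ := false) hg hc hX hn1 hmenu hmir hFull hTD hInv hdsg_up
    hdsg_inv hrise (fun v => rfl) hV hP'X hP'top hsrc hR₀3 hρ rfl hcell' hP₂X hP₂ hsh hnon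
  -- (2) the sources
  have hsources := card_vertical_tops_ge (F false) s₁ X P₁ P' R₀ ρ zcut hR₀3 hρ (by rw [hzcut]; linarith)
    hX hP₁X hP₁ hP'iff humax (by rw [← apply_two_eq_inner_e₃]; exact hα₁.le)
  -- (3) the band
  have hband := card_band_le_lineCount (F false) s₂ P₂ h R₀ ρ zcut hρ0 (by rw [hzcut]; linarith)
    (by rw [hzcut]; linarith) hP₂ humin (by rw [← apply_two_eq_inner_e₃]; exact hα₂)
  -- (4) the rim band
  set RIMT := X.filter fun s => zcut ≤ s 2 ∧ s 2 ≤ zcut + 1 ∧ (ρ - 2) ^ 2 < s 0 ^ 2 + s 1 ^ 2 with hRIMT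
  have hrim : (RIMT.card : ℝ) ≤ 144 * ρ := by
    have hsep : ∀ p ∈ RIMT, ∀ q ∈ RIMT, p ≠ q → 1 ≤ dist p q :=
      fun p hp q hq hpq => hX p (mem_filter.1 hp).1 q (mem_filter.1 hq).1 hpq
    have hmem : ∀ p ∈ RIMT, zcut ≤ p 2 ∧ p 2 ≤ zcut + 1 ∧ (ρ - 2) ^ 2 < p 0 ^ 2 + p 1 ^ 2 ∧
        p 0 ^ 2 + p 1 ^ 2 ≤ ρ ^ 2 := by
      intro p hp
      obtain ⟨hpX, h1, h2, h3⟩ := mem_filter.1 hp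
      exact ⟨h1, h2, h3, (hcell p hpX).2.2⟩
    have key := card_mul_le_of_separated_in_shell RIMT hsep zcut (zcut + 1) (ρ - 2) ρ (by linarith)
      (by linarith) (by linarith) hmem
    have e : (zcut + 1 - zcut + 2) * (Real.pi * (ρ + 1) ^ 2 - Real.pi * (ρ - 2 - 1) ^ 2) =
        (Real.pi / 6) * (144 * ρ - 144) := by ring
    rw [e] at key
    have hπ : 0 < Real.pi / 6 := by positivity
    have := le_of_mul_le_mul_right (by linarith [key] : (RIMT.card : ℝ) * (Real.pi / 6) ≤
      (144 * ρ - 144) * (Real.pi / 6)) hπ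
    linarith
  -- (5) the states of foreign twin dozens are at most two per ball
  set FORb := X.filter fun b => ∃ c : Bool, ∃ n' : EuclideanSpace ℝ (Fin 3), ‖n'‖ = 1 ∧ n' ≠ n ∧ n' ≠ -n ∧
      (∀ w ∈ fccSlots, ⟪F c w, n'⟫_ℝ = 0 ∨ ⟪F c w, n'⟫_ℝ = Real.sqrt (2 / 3) ∨
        ⟪F c w, n'⟫_ℝ = -Real.sqrt (2 / 3)) ∧
      (∀ w ∈ fccSlots, ⟪F c w, n'⟫_ℝ ≤ 0 → b + F c w ∈ X) ∧
      (∀ w ∈ fccSlots, ⟪F c w, n'⟫_ℝ < 0 → b + (F c w - (2 * ⟪F c w, n'⟫_ℝ) • n') ∈ X) ∧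
      (∀ w ∈ fccSlots, 0 < ⟪F c w, n'⟫_ℝ → b + F c w ∉ X) with hFORb
  have hfor : (V.filter fun v => ∃ n' : EuclideanSpace ℝ (Fin 3), ‖n'‖ = 1 ∧ n' ≠ n ∧ n' ≠ -n ∧
        (∀ w ∈ fccSlots, ⟪F v.2 w, n'⟫_ℝ = 0 ∨ ⟪F v.2 w, n'⟫_ℝ = Real.sqrt (2 / 3) ∨
          ⟪F v.2 w, n'⟫_ℝ = -Real.sqrt (2 / 3)) ∧
        (∀ w ∈ fccSlots, ⟪F v.2 w, n'⟫_ℝ ≤ 0 → v.1 + F v.2 w ∈ X) ∧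
        (∀ w ∈ fccSlots, ⟪F v.2 w, n'⟫_ℝ < 0 → v.1 + (F v.2 w - (2 * ⟪F v.2 w, n'⟫_ℝ) • n') ∈ X) ∧
        (∀ w ∈ fccSlots, 0 < ⟪F v.2 w, n'⟫_ℝ → v.1 + F v.2 w ∉ X)).card ≤ 2 * FORb.card := by
    have hsub : (V.filter fun v => ∃ n' : EuclideanSpace ℝ (Fin 3), ‖n'‖ = 1 ∧ n' ≠ n ∧ n' ≠ -n ∧
        (∀ w ∈ fccSlots, ⟪F v.2 w, n'⟫_ℝ = 0 ∨ ⟪F v.2 w, n'⟫_ℝ = Real.sqrt (2 / 3) ∨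
          ⟪F v.2 w, n'⟫_ℝ = -Real.sqrt (2 / 3)) ∧
        (∀ w ∈ fccSlots, ⟪F v.2 w, n'⟫_ℝ ≤ 0 → v.1 + F v.2 w ∈ X) ∧
        (∀ w ∈ fccSlots, ⟪F v.2 w, n'⟫_ℝ < 0 → v.1 + (F v.2 w - (2 * ⟪F v.2 w, n'⟫_ℝ) • n') ∈ X) ∧
        (∀ w ∈ fccSlots, 0 < ⟪F v.2 w, n'⟫_ℝ → v.1 + F v.2 w ∉ X)) ⊆ FORb ×ˢ (univ : Finset Bool) := by
      intro v hv
      rw [mem_filter] at hv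
      obtain ⟨hvV, n', h1, h2, h3, h4, h5, h6, h7⟩ := hv
      rw [mem_product, hFORb, mem_filter]
      exact ⟨⟨((hV v).1 hvV).1, v.2, n', h1, h2, h3, h4, h5, h6, h7⟩, mem_univ _⟩
    have := card_le_card hsub
    rw [card_product, card_univ, Fintype.card_bool] at this
    omega
  -- (6) arithmetic
  set α₁ := (F false umax) 2 with hα₁def
  set α₂ := (F false umin) 2 with hα₂def
  set K := (R₀ - 1) / 2 + 4 with hKdef
  have hα₁' : ⟪F false umax, EuclideanSpace.single (2 : Fin 3) (1 : ℝ)⟫_ℝ = α₁ := (apply_two_eq_inner_e₃ _).symm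
  have hα₂' : ⟪F false umin, EuclideanSpace.single (2 : Fin 3) (1 : ℝ)⟫_ℝ = α₂ := (apply_two_eq_inner_e₃ _).symm
  have hα₁le : α₁ ≤ 1 := by
    rw [← hα₁']; exact (abs_le.1 (abs_inner_slot_le_one (F false) humax)).2
  rw [hα₁', abs_of_pos hα₁] at hsources
  rw [hα₂'] at hband
  have hzK : (h + 2 * R₀ - zcut) / 2 + 4 = K := by rw [hzcut, hKdef]; ring
  rw [hzK] at hband
  -- the integer count, cast to ℝ
  have hcoreR := hcore
  have hcast : ((P'.filter fun p => (∀ w ∈ fccSlots, p + F false w ∈ X) ∧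
      zlo < (p + F false umax) 2 ∧ (p + F false umax) 2 < zcut).card : ℝ) ≤
      26 * ((X.filter fun z => (X.filter fun q => dist z q = 1).card ≤ 11 ∧
          zlo - 1 ≤ z 2 ∧ z 2 ≤ zcut + 1).card : ℝ) + (2 * FORb.card : ℕ) +
      ((P₂.filter fun s => zcut ≤ s 2 ∧ s 2 < zcut + α₂).card : ℝ) + 2 * (RIMT.card : ℝ) := by
    have h0 : (P'.filter fun p => (∀ w ∈ fccSlots, p + F false w ∈ X) ∧
        zlo < (p + F false umax) 2 ∧ (p + F false umax) 2 < zcut).card ≤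
        26 * (X.filter fun z => (X.filter fun q => dist z q = 1).card ≤ 11 ∧
          zlo - 1 ≤ z 2 ∧ z 2 ≤ zcut + 1).card + 2 * FORb.card +
        (P₂.filter fun s => zcut ≤ s 2 ∧ s 2 < zcut + α₂).card + 2 * RIMT.card := by
      have := hcoreR; omega
    exact_mod_cast h0
  -- identify the payer windows
  have hPAYeq : (X.filter fun z => (X.filter fun q => dist z q = 1).card ≤ 11 ∧
      zlo - 1 ≤ z 2 ∧ z 2 ≤ zcut + 1) = (X.filter fun z => (X.filter fun q => dist z q = 1).card ≤ 11 ∧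
      -R₀ - 2 ≤ z 2 ∧ z 2 ≤ h + R₀ + 2) := by
    refine filter_congr fun z _ => ?_
    rw [hzlo, hzcut, show -R₀ - 1 - 1 = -R₀ - 2 by ring, show h + R₀ + 1 + 1 = h + R₀ + 2 by ring]
  rw [hPAYeq] at hcast
  -- the sources filter of `card_vertical_tops_ge` is the one of the core (`zlo = −R₀ − 1`)
  have hsrc' : Real.sqrt 2 * α₁ * Real.pi * (ρ - 1) ^ 2 - 10 * Real.sqrt 2 * Real.pi * (ρ - 1) - 36 * R₀ * ρ ≤
      ((P'.filter fun p => (∀ w ∈ fccSlots, p + F false w ∈ X) ∧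
        zlo < (p + F false umax) 2 ∧ (p + F false umax) 2 < zcut).card : ℝ) := by
    convert hsources using 4
  -- expand the band bound
  have hα₂ne : α₂ ≠ 0 := hα₂.ne'
  have hband' : ((P₂.filter fun s => zcut ≤ s 2 ∧ s 2 < zcut + α₂).card : ℝ) ≤
      Real.sqrt 2 * α₂ * Real.pi * ρ ^ 2 + 2 * Real.sqrt 2 * Real.pi * K * ρ + Real.sqrt 2 * Real.pi * K ^ 2 / α₂ := by
    have e : Real.sqrt 2 * α₂ * Real.pi * (ρ + K / α₂) ^ 2 =
        Real.sqrt 2 * α₂ * Real.pi * ρ ^ 2 + 2 * Real.sqrt 2 * Real.pi * K * ρ + Real.sqrt 2 * Real.pi * K ^ 2 / α₂ := by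
      field_simp; ring
    rw [← e]; exact hband
  have h2 : 0 ≤ Real.sqrt 2 := Real.sqrt_nonneg _
  have hπ : 0 ≤ Real.pi := Real.pi_pos.le
  have hsq : Real.sqrt 2 * α₁ * Real.pi * (ρ - 1) ^ 2 ≥ Real.sqrt 2 * α₁ * Real.pi * ρ ^ 2 - 2 * Real.sqrt 2 * Real.pi * ρ := by
    have hα₁0 : 0 ≤ α₁ := by rw [hα₁def]; exact hα₁.le
    have : Real.sqrt 2 * α₁ * Real.pi * (ρ - 1) ^ 2 = Real.sqrt 2 * α₁ * Real.pi * ρ ^ 2 -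
        2 * Real.sqrt 2 * α₁ * Real.pi * ρ + Real.sqrt 2 * α₁ * Real.pi := by ring
    rw [this]
    have h1 : Real.sqrt 2 * α₁ * Real.pi * ρ ≤ Real.sqrt 2 * Real.pi * ρ := by
      have := mul_le_mul_of_nonneg_left hα₁le (by positivity : 0 ≤ Real.sqrt 2 * Real.pi * ρ)
      have e1 : Real.sqrt 2 * α₁ * Real.pi * ρ = Real.sqrt 2 * Real.pi * ρ * α₁ := by ring
      rw [mul_one] at this; rw [e1]; exact this
    have h3 : 0 ≤ Real.sqrt 2 * α₁ * Real.pi := mul_nonneg (mul_nonneg h2 hα₁0) hπ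
    linarith
  have hFORbR : ((2 * FORb.card : ℕ) : ℝ) = 2 * (FORb.card : ℝ) := by push_cast; ring
  rw [hFORbR] at hcast
  have h2π : 0 ≤ Real.sqrt 2 * Real.pi := mul_nonneg h2 hπ
  linarith [hcast, hsrc', hband', hrim, hsq]

end Summit.Ventures.Crystal3D.Theorems

end
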